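import Literature.MathematicalPhysics.QuantumFieldTheory.Balaban1983to89.B12Eq443LatticeMoments
import Literature.MathematicalPhysics.QuantumFieldTheory.Balaban1983to89.B12Transverse536

/-!
# B12 p. 291–292: Bałaban's `Δ_j` HAS «an expansion of the form (4.41) with a coefficient» — coefficient `1`:
# the `ℤ^{d+1}` kernel of the typed `Δ_j` has the second-order Taylor data of the Wilson transverse form and decays
# exponentially with `j`-UNIFORM constants, hence (periodic Gleason lemma) (4.41) with the «terms of higher order
# in p′» EXHIBITED: `Δ_j = Q + Σ_{κλϱ} Δ*_κΔ*_λΔ*_ϱ Δ′_j`, `|Δ′_j(x)| ≤ K³(MC + MQ)e^{−a|x|₁}` for every `j`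

statement-level skeleton of published theorems with citation tags; proofs where landed; nothing here is a
claim about the Yang–Mills mass gap.

Source: T. Bałaban, *Renormalization group approach to lattice gauge field theories. I*, Commun. Math. Phys.
**109** (1987) 249–301 (`Balaban1987RG1`, "B12"), pp. 290–292 [PDF 42–44] and p. 297 [PDF 49] (held:
`lit read paper:balaban1987-cmp109-rg-i-small-field --pages 42-44`; journal page = PDF page + 248).
PDF held: yes.  Unit `lit-balaban` (HOME `run/shared/lean/pub/lit-balaban/`), Phase-2 proof seat p10 (gen 8, file
1/2); WHAT IS REPRODUCED = SKELETON rows `B12.Eq4.41` and `B12.Eq4.42-4.45` — the structural input of the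
paragraph (4.40)–(4.45) for the TYPED `Δ_j` (`B12Eq441SymbolExpansion.symbDeltaJ` = [B5] (1.66) [10], its
`ℤ^{d+1}` kernel `B12Eq443LatticeMoments.kerDeltaJ`), in the currency of the lineage's §5 modules (`B12Rep537`).
File 2/2 (`B12Eq442DeltaJ`) draws the consequences (4.42), (4.44), (4.45) and the p. 292 cancellation.

## What the paper prints (verbatim, B12 pp. 290–292)

p. 290: «Next, we extend summations over y to the whole lattice Z⁴. The difference between the sum over supp ζ̃_□
and the sum over Z⁴ is a sum over a subset of (□̃³)ᶜ∩Z⁴. This gives again the exponentially small coefficients.»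
p. 291: «… = β_j(g_{j−1})Δ_j,   (4.40)   where Δ_j is given by the explicit formula (1.66) [10]. […] The function
Δ_{j,μν}(x − y) in the momentum representation of (1.66) has the following expansion around 0:
  Δ̃_{j,μν}(p′) = Δ₀(p′)δ_{μν} − ∂̄¹_μ(p′)∂¹_ν(p′) + (terms of higher order in p′),   (4.41)
see (1.29)–(1.37) [10] for an explanation of symbols used in connection with momentum representations.»
p. 292: «Thus the only terms in the expansion of (4.38), which we do not control yet, more exactly for which the sum
over j has not a uniform bound, are terms (4.42), (4.44). In the next section we will prove that the polarization
tensor Π has a similar structure as the operator Δ_j, especially it has an expansion of the form (4.41), but with a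
coefficient.»
p. 297 (the «structure» in question, for Π): «Π_{μν}(p′) = β(δ_{μν}Δ(p′) − ∂̄_μ(p′)∂_ν(p′)) + Σ_{κ,λ,ϱ} ∂̄_κ(p′)∂̄_λ(p′)
∂̄_ϱ(p′)Π′_{μν,κλϱ}(p′),   (5.37)» (quoted in full with (5.36), (5.38), (5.44) in the header of `B12Rep537`).

## Dictionary (everything is the tree's; this module introduces NO definition)

* `kerDeltaJ n μ ν : Pt (d+1) → ℂ` (`Pt d = Fin d → ℤ`, `n = L^j ≥ 1`) is `Δ_{j,μν}(x)` on the unit lattice `ℤ^{d+1}`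
  (y-sums «over the whole lattice», p. 290), the kernel of the typed symbol `Δ̃_{j,μν}` (gen 7).
* «an expansion of the form (4.41) with a coefficient β» = `B12Rep537.TaylorData3 β μ ν` (every lattice moment of
  order ≤ 2 of the component equals `β ×` that of the Wilson transverse kernel `B12Rep537.wilsonQ μ ν`, the kernel of
  `δ_{μν}Δ₀(p′) − ∂̄¹_μ(p′)∂¹_ν(p′)`) + the decay `PeriodicGleason.ExpBound a M` (`|·(x)| ≤ Me^{−a|x|₁}`); the periodic
  Gleason lemma `B12Rep537.rep538` turns the pair into (5.37)/(5.38) = (4.41) with explicit third-order remainder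
  `B12Rep537.rem538`, and `B12Rep537.rep537_genFun` is its momentum-space (generating-function) form.
* Constants: `a = κ₁₆₆(d+1)/(d+1)` (`B5Symbol166Strip.kappa166`), `MC = B12Eq443LatticeMoments.MC (d+1) (κ₁₆₆(d+1))`,
  `K = PeriodicGleason.K`, `MQ = B12Rep537.MQ`, `Z_{d+1} = PeriodicGleason.Zd` — NONE depends on `j`.

## What this module proves (kernel-checked; every `n = L^j ≥ 1`, every dimension `d + 1 ≥ 1`, all `μ ν`)

* §1 `hasSum_kerDeltaJ` / `tsum_kerDeltaJ`: `Σ_x Δ_{j,μν}(x) = Δ̃_{j,μν}(0) = 0` (gen-7 Fourier inversion at `p′ = 0`,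
  `B12Eq443SymbolHessian.symbDeltaJ_zero`).
* §2 `expBound_kerDeltaJ`: `ExpBound a MC (Δ_{j,μν})` (gen-7 `norm_kerDeltaJ_le` + `|x|₁ ≤ (d+1)|x|_∞`).
* §3 **`taylorData3_kerDeltaJ : TaylorData3 1 μ ν (kerDeltaJ n μ ν)`** — `Δ_j` has «the structure» with coefficient
  `1` (gen-7 `tsum_coord_mul_kerDeltaJ`, `tsum_coord_mul_coord_mul_kerDeltaJ` + `hess_eDir` + §1, through
  `B12Transverse536.taylorData3_of_moments`).
* §4 **(4.41) with the higher-order terms exhibited**: `rep441` (position space: `Δ_{j,μν} − Q_{μν} = Σ Δ*Δ*Δ*Δ′`,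
  `|Δ′(x)| ≤ K(a,d+1)³(MC + MQ(a,d+1))e^{−a|x|₁}`), `genFun_kerDeltaJ` (the G–K generating function at `z = e^{−ip′}`
  IS `Δ̃_{j,μν}(p′)` on the open zone), `leading_eq_transverseSym` (its leading term is gen-6's `transverseSym` letter
  for letter) and **`eq441_explicit`**: `Δ̃_{j,μν}(p′) = [Δ₀(p′)δ_{μν} − ∂̄¹_μ(p′)∂¹_ν(p′)] + Σ_{(κ,λ,ϱ)}
  ∂̄¹_κ(p′)∂̄¹_λ(p′)∂̄¹_ϱ(p′)Δ̃′_{j,μν,κλϱ}(p′)`, `|Δ̃′| ≤ K³(MC + MQ)Z_{d+1}(a)` for all `p′` and all `j`.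

## What is NOT claimed

The passage (4.35)–(4.40) from `E^{(2)}` to `β_jΔ_j`; that Bałaban's `Π` has the structure (that is §5 of the paper,
rows B12.Eq5.*); any irrelevance statement; torus periodisation of the y-sums (the print extends them to `Z⁴`,
p. 290); (1.65) = (1.66) (row B5.Eq1.66).  Gen 6 (`B12Eq441SymbolExpansion.norm_symbDeltaJ_sub_transverseSym_le`)
bounds the same remainder by `2(π²/4)^{2d+4}|p′|⁴` directly; the present form is the one the lineage's (5.43)/(4.34)
machinery consumes.  Nothing here is progress on a summit.
-/

noncomputable section

namespace Literature.MathematicalPhysics.QuantumFieldTheory.Balaban1983to89.B12Eq441DeltaJStructure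

open scoped BigOperators Topology Real ComplexConjugate
open Finset Complex Filter
open Literature.MathematicalPhysics.QuantumFieldTheory.GawedzkiKupiainen1985.PeriodicGleason
  (Pt wt l1 ExpBound deltaIter K genFun PolyAnnulus Zd zpowv)
open Literature.MathematicalPhysics.QuantumFieldTheory.Balaban1983to89.B12Rep537
  (TaylorData3 wilsonQ kron rem538 MQ rep538 rep537_genFun)
open Literature.MathematicalPhysics.QuantumFieldTheory.Balaban1983to89.B12Transverse536 (taylorData3_of_moments)
open Literature.MathematicalPhysics.QuantumFieldTheory.Balaban1983to89.B4ContourShift (phase supNorm abs_le_supNorm)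
open Literature.MathematicalPhysics.QuantumFieldTheory.Balaban1983to89.B5Symbol166Strip (kappa166 kappa166_pos MW_pos)
open Literature.MathematicalPhysics.QuantumFieldTheory.Balaban1983to89.B5Prop11Fiber (d1Sym Delta0_eq)
open Literature.MathematicalPhysics.QuantumFieldTheory.Balaban1983to89.B12Eq441SymbolExpansion
  (symbDeltaJ transverseSym)
open Literature.MathematicalPhysics.QuantumFieldTheory.Balaban1983to89.B12Eq443SymbolHessian
  (zone eDir hess kdR symbDeltaJ_zero hess_eDir)
open Literature.MathematicalPhysics.QuantumFieldTheory.Balaban1983to89.B12Eq443LatticeMoments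
  (kerDeltaJ MC norm_kerDeltaJ_le hasSum_kerDeltaJ_phase tsum_coord_mul_kerDeltaJ
    tsum_coord_mul_coord_mul_kerDeltaJ)

variable {d : ℕ}

section Kernel

variable (n : ℕ) [NeZero n] (μ ν : Fin (d + 1))

/-! ## §1. The zeroth moment: `Σ_x Δ_{j,μν}(x) = Δ̃_{j,μν}(0) = 0` -/

/-- `0` lies in the open Brillouin zone. [folklore] -/
private theorem zero_mem_zone : (0 : Fin (d + 1) → ℝ) ∈ zone (d + 1) := fun κ => by simp [Real.pi_pos]

/-- **no mass term**: `Σ_{x ∈ ℤ^{d+1}} Δ_{j,μν}(x) = Δ̃_{j,μν}(0) = 0`, every `n = L^j ≥ 1` (Fourier inversion at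
`p′ = 0`; `Δ₀(0) = 0`, `∂¹(0) = 0` in (4.41)). [cite: Balaban1987RG1, (4.41) p.291] -/
theorem hasSum_kerDeltaJ : HasSum (kerDeltaJ n μ ν) 0 := by
  have h := hasSum_kerDeltaJ_phase n μ ν 0 zero_mem_zone
  rw [symbDeltaJ_zero] at h
  have e : (fun x : Fin (d + 1) → ℤ => kerDeltaJ n μ ν x * cexp (-(I * phase 0 x))) = kerDeltaJ n μ ν := by
    funext x
    simp [phase]
  rw [e] at h
  exact h

/-- `Σ_{x ∈ ℤ^{d+1}} Δ_{j,μν}(x) = 0`. [cite: Balaban1987RG1, (4.41) p.291] -/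
theorem tsum_kerDeltaJ : ∑' x, kerDeltaJ n μ ν x = 0 := (hasSum_kerDeltaJ n μ ν).tsum_eq

/-! ## §2. Exponential decay in the `ℓ¹` currency of the periodic Gleason lemma, uniformly in `j` -/

/-- `0 ≤ MC`. [folklore] -/
private theorem MC_nonneg (d : ℕ) (κ : ℝ) : 0 ≤ MC d κ := by
  unfold MC; have := MW_pos d; positivity

/-- `|x|₁ ≤ (d+1)|x|_∞` on `ℤ^{d+1}`. [folklore] -/
private theorem l1_le_mul_supNorm (x : Fin (d + 1) → ℤ) : l1 x ≤ (d + 1 : ℝ) * supNorm x := by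
  unfold l1
  calc ∑ j, |((x j : ℤ) : ℝ)| ≤ ∑ _j : Fin (d + 1), supNorm x :=
        Finset.sum_le_sum fun j _ => by
          have h := abs_le_supNorm x j
          push_cast at h
          exact h
    _ = (d + 1 : ℝ) * supNorm x := by
        rw [Finset.sum_const, Finset.card_univ, Fintype.card_fin, nsmul_eq_mul]
        push_cast
        ring

/-- **decay of `Δ_{j,μν}`, `ℓ¹` form, `j`-uniform constants**: `‖Δ_{j,μν}(x)‖ ≤ MC · e^{−(κ₁₆₆/(d+1))|x|₁}`, i.e.
`ExpBound (κ₁₆₆(d+1)/(d+1)) MC (Δ_{j,μν})` for every `n = L^j ≥ 1`. [cite: Balaban1987RG1, (4.41) p.291] -/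
theorem expBound_kerDeltaJ :
    ExpBound (kappa166 (d + 1) / (d + 1)) (MC (d + 1) (kappa166 (d + 1))) (kerDeltaJ n μ ν) := by
  intro x
  refine (norm_kerDeltaJ_le n μ ν x).trans ?_
  unfold wt
  have hκ : 0 < kappa166 (d + 1) := kappa166_pos _
  have hd : (0 : ℝ) < d + 1 := by positivity
  refine mul_le_mul_of_nonneg_left (Real.exp_le_exp.mpr ?_) (MC_nonneg _ _)
  have h1 := l1_le_mul_supNorm x
  have : kappa166 (d + 1) / (d + 1) * l1 x ≤ kappa166 (d + 1) * supNorm x := by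
    calc kappa166 (d + 1) / (d + 1) * l1 x ≤ kappa166 (d + 1) / (d + 1) * ((d + 1 : ℝ) * supNorm x) :=
          mul_le_mul_of_nonneg_left h1 (div_nonneg hκ.le hd.le)
      _ = kappa166 (d + 1) * supNorm x := by field_simp
  linarith

/-- the decay rate is positive. [folklore] -/
private theorem rate_pos : 0 < kappa166 (d + 1) / (d + 1) := div_pos (kappa166_pos _) (by positivity)

/-! ## §3. «an expansion of the form (4.41) with a coefficient»: `Δ_j` has the second-order Taylor data of the
Wilson transverse form with coefficient `1` -/

/-- the real and complex Kronecker symbols of the lineage agree. [folklore] -/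
private theorem kdR_cast (a b : Fin (d + 1)) : ((kdR a b : ℝ) : ℂ) = kron a b := by
  unfold kdR kron; split_ifs <;> simp

/-- **`Δ_j` has the structure (5.36) with `β = 1`** — «the polarization tensor Π has a similar structure as the
operator Δ_j, especially it has an expansion of the form (4.41), but with a coefficient»: every lattice moment of
order `≤ 2` of `Δ_{j,μν}` on `ℤ^{d+1}` equals the corresponding moment of the Wilson transverse kernel `Q_{μν}`
(`Σ_xΔ = 0`, `Σ_xΔx_κ = 0`, `Σ_xΔx_κx_λ = δ_{μκ}δ_{νλ} + δ_{μλ}δ_{νκ} − 2δ_{μν}δ_{κλ}`), for every `n = L^j ≥ 1`.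
[cite: Balaban1987RG1, (4.41) p.291; p.292; (4.43), (4.45)] -/
theorem taylorData3_kerDeltaJ : TaylorData3 1 μ ν (kerDeltaJ n μ ν) := by
  refine taylorData3_of_moments (tsum_kerDeltaJ n μ ν) (fun κ => ?_) (fun κ τ => ?_)
  · rw [← tsum_coord_mul_kerDeltaJ n μ ν κ]
    exact tsum_congr fun x => mul_comm _ _
  · have h := tsum_coord_mul_coord_mul_kerDeltaJ n μ ν κ τ
    rw [hess_eDir, neg_neg] at h
    rw [one_mul]
    calc ∑' x : Pt (d + 1), kerDeltaJ n μ ν x * (((x κ : ℤ) : ℂ) * ((x τ : ℤ) : ℂ))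
          = ∑' x : Pt (d + 1), ((x κ : ℤ) : ℂ) * ((x τ : ℤ) : ℂ) * kerDeltaJ n μ ν x :=
            tsum_congr fun x => by ring
      _ = (((kdR μ κ * kdR ν τ + kdR μ τ * kdR ν κ - 2 * (kdR μ ν * kdR κ τ) : ℝ)) : ℂ) := h
      _ = -(2 * kron μ ν * kron τ κ) + kron κ μ * kron τ ν + kron κ ν * kron τ μ := by
            push_cast
            simp only [kdR_cast]
            rw [B12Rep537.kron_comm τ κ, B12Rep537.kron_comm κ μ, B12Rep537.kron_comm τ ν,
              B12Rep537.kron_comm κ ν, B12Rep537.kron_comm τ μ]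
            ring

/-- the whole family at once. [cite: Balaban1987RG1, (4.41) p.291; p.292] -/
theorem taylorData3_kerDeltaJ_family : ∀ μ ν : Fin (d + 1), TaylorData3 1 μ ν (kerDeltaJ n μ ν) :=
  fun μ ν => taylorData3_kerDeltaJ n μ ν

/-! ## §4. (4.41) with the higher-order terms EXHIBITED: `Δ_j = Q + Σ Δ*Δ*Δ* Δ′_j`, remainder kernels bounded
uniformly in `j` -/

/-- **(4.41) in position space = the representation (5.37)/(5.38) for `Δ_j`, coefficient `1`, with the bound behind
(5.44) UNIFORM IN `j`**: `Δ_{j,μν}(x) − Q_{μν}(x) = Σ_{(κ,λ,ϱ)} (Δ*_κΔ*_λΔ*_ϱ Δ′_{j,μν,κλϱ})(x)` on `ℤ^{d+1}` (backward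
differences on the kernel, `Q_{μν} = wilsonQ μ ν` the kernel of `Δ₀(p′)δ_{μν} − ∂̄¹_μ(p′)∂¹_ν(p′)`), the remainder kernels
`Δ′_{j,μν,κλϱ} = rem538 (Δ_{j,μν}) 1 μ ν (κ,λ,ϱ)` obeying `|Δ′(x)| ≤ K(a,d+1)³·(MC + MQ(a,d+1))·e^{−a|x|₁}`,
`a = κ₁₆₆(d+1)/(d+1)`, for every `n = L^j ≥ 1` — the «terms of higher order in p′» of (4.41), via the periodic Gleason
lemma `B12Rep537.rep538`. [cite: Balaban1987RG1, (4.41) p.291; (5.37)–(5.38) p.297] -/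
theorem rep441 :
    (∀ x, kerDeltaJ n μ ν x - wilsonQ μ ν x =
        ∑ μs : Fin 3 → Fin (d + 1), deltaIter 3 μs (rem538 (kerDeltaJ n μ ν) 1 μ ν μs) x) ∧
      ∀ μs : Fin 3 → Fin (d + 1), ExpBound (kappa166 (d + 1) / (d + 1))
        (K (kappa166 (d + 1) / (d + 1)) (d + 1) ^ 3 *
          (MC (d + 1) (kappa166 (d + 1)) + MQ (kappa166 (d + 1) / (d + 1)) (d + 1)))
        (rem538 (kerDeltaJ n μ ν) 1 μ ν μs) := by
  obtain ⟨h1, h2⟩ := rep538 rate_pos (expBound_kerDeltaJ n μ ν) (taylorData3_kerDeltaJ n μ ν)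
  refine ⟨fun x => ?_, fun μs => ?_⟩
  · have h := h1 x
    rwa [one_mul] at h
  · have h := h2 μs
    rwa [norm_one, one_mul] at h

/-- the remainder kernels, pointwise: `|Δ′_{j,μν,κλϱ}(x)| ≤ K(a,d+1)³(MC + MQ(a,d+1))e^{−a|x|₁}`, constants independent
of `j`. [cite: Balaban1987RG1, (4.41) p.291; (5.44) p.297] -/
theorem norm_rem_le (μs : Fin 3 → Fin (d + 1)) (x : Pt (d + 1)) :
    ‖rem538 (kerDeltaJ n μ ν) 1 μ ν μs x‖ ≤
      K (kappa166 (d + 1) / (d + 1)) (d + 1) ^ 3 *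
        (MC (d + 1) (kappa166 (d + 1)) + MQ (kappa166 (d + 1) / (d + 1)) (d + 1)) *
        Real.exp (-(kappa166 (d + 1) / (d + 1)) * l1 x) :=
  (rep441 n μ ν).2 μs x

/-- `e^{−ip′}` is a point of every closed poly-annulus of width `b ≥ 0`. [folklore] -/
private theorem expVec_mem_polyAnnulus (p : Fin (d + 1) → ℝ) {b : ℝ} (hb : 0 ≤ b) :
    (fun j => cexp (-(I * p j))) ∈ PolyAnnulus (d + 1) b := by
  intro j
  have h : ‖cexp (-(I * p j))‖ = 1 := by
    rw [show -(I * (p j : ℂ)) = ((-p j : ℝ) : ℂ) * I by push_cast; ring, Complex.norm_exp_ofReal_mul_I]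
  simp only [h]
  exact ⟨Real.exp_le_one_iff.mpr (neg_nonpos.mpr hb), Real.one_le_exp hb⟩

/-- `zˣ = e^{−ip′·x}` at `z = e^{−ip′}`. [folklore] -/
private theorem zpowv_expVec (p : Fin (d + 1) → ℝ) (x : Fin (d + 1) → ℤ) :
    zpowv (fun j => cexp (-(I * p j))) x = cexp (-(I * phase p x)) := by
  unfold zpowv
  calc ∏ j, cexp (-(I * p j)) ^ (x j) = ∏ j, cexp ((x j : ℂ) * (-(I * p j))) :=
        Finset.prod_congr rfl fun j _ => (Complex.exp_int_mul _ _).symm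
    _ = cexp (∑ j, (x j : ℂ) * (-(I * p j))) := (Complex.exp_sum _ _).symm
    _ = cexp (-(I * phase p x)) := by
        congr 1
        unfold phase
        rw [Finset.mul_sum, ← Finset.sum_neg_distrib]
        exact Finset.sum_congr rfl fun j _ => by ring

/-- **the G–K generating function of `Δ_{j,μν}` at `z = e^{−ip′}` IS the typed symbol `Δ̃_{j,μν}(p′)`** on the open
zone `|p′_i| < π` (gen-7 Fourier inversion `hasSum_kerDeltaJ_phase`). [cite: Balaban1987RG1, (4.41) p.291] -/
theorem genFun_kerDeltaJ (p : Fin (d + 1) → ℝ) (hp : p ∈ zone (d + 1)) :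
    genFun (kerDeltaJ n μ ν) (fun j => cexp (-(I * p j))) = symbDeltaJ n p μ ν := by
  unfold genFun
  simp_rw [zpowv_expVec]
  exact (hasSum_kerDeltaJ_phase n μ ν p hp).tsum_eq

omit [NeZero n] in
/-- the leading term of the G–K multiplicative form at `z = e^{−ip′}` is gen-6's transverse symbol LETTER FOR
LETTER: `δ_{μν}Σ_κ(z_κ − 1)(z_κ⁻¹ − 1) − (z_μ − 1)(z_ν⁻¹ − 1) = Δ₀(p′)δ_{μν} − ∂̄¹_μ(p′)∂¹_ν(p′)` (`transverseSym p′ μ ν`).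
[cite: Balaban1987RG1, (4.41) p.291] -/
theorem leading_eq_transverseSym (p : Fin (d + 1) → ℝ) :
    ((if μ = ν then ∑ κ, (cexp (-(I * p κ)) - 1) * ((cexp (-(I * p κ)))⁻¹ - 1) else 0)
      - (cexp (-(I * p μ)) - 1) * ((cexp (-(I * p ν)))⁻¹ - 1)) = transverseSym p μ ν := by
  have hz : ∀ κ, cexp (-(I * p κ)) - 1 = conj (d1Sym p κ) := by
    intro κ
    unfold d1Sym
    rw [map_sub, map_one, ← Complex.exp_conj, map_mul, Complex.conj_ofReal, Complex.conj_I]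
    congr 2
    ring
  have hzi : ∀ κ, (cexp (-(I * p κ)))⁻¹ - 1 = d1Sym p κ := by
    intro κ
    unfold d1Sym
    rw [← Complex.exp_neg]
    congr 2
    ring
  unfold transverseSym
  simp_rw [hz, hzi]
  congr 1
  split_ifs
  · rw [Delta0_eq]
    push_cast
    exact Finset.sum_congr rfl fun κ _ => by rw [Complex.conj_mul']
  · rfl

/-- **(4.41) with the «terms of higher order in p′» EXHIBITED, bounded uniformly in `j`**: on the open zone,
`Δ̃_{j,μν}(p′) = [Δ₀(p′)δ_{μν} − ∂̄¹_μ(p′)∂¹_ν(p′)] + Σ_{(κ,λ,ϱ)} ∂̄¹_κ(p′)∂̄¹_λ(p′)∂̄¹_ϱ(p′)·Δ̃′_{j,μν,κλϱ}(p′)`,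
`∂̄¹_κ(p′) = e^{−ip′_κ} − 1`, every `Δ̃′` (the generating function of the §4 remainder kernel) bounded by
`K(a,d+1)³(MC + MQ(a,d+1))·Z_{d+1}(a)` for ALL `p′` and ALL `n = L^j ≥ 1`. [cite: Balaban1987RG1, (4.41) p.291] -/
theorem eq441_explicit (p : Fin (d + 1) → ℝ) (hp : p ∈ zone (d + 1)) :
    symbDeltaJ n p μ ν = transverseSym p μ ν +
        ∑ μs : Fin 3 → Fin (d + 1), (∏ j, (cexp (-(I * p (μs j))) - 1)) *
          genFun (rem538 (kerDeltaJ n μ ν) 1 μ ν μs) (fun j => cexp (-(I * p j))) ∧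
      ∀ μs : Fin 3 → Fin (d + 1),
        ‖genFun (rem538 (kerDeltaJ n μ ν) 1 μ ν μs) (fun j => cexp (-(I * p j)))‖ ≤
          K (kappa166 (d + 1) / (d + 1)) (d + 1) ^ 3 *
            (MC (d + 1) (kappa166 (d + 1)) + MQ (kappa166 (d + 1) / (d + 1)) (d + 1)) *
            Zd (kappa166 (d + 1) / (d + 1)) (d + 1) := by
  have hmem := expVec_mem_polyAnnulus p (le_refl (0 : ℝ))
  obtain ⟨h1, h2⟩ := rep537_genFun rate_pos (expBound_kerDeltaJ n μ ν) (taylorData3_kerDeltaJ n μ ν)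
    rate_pos hmem
  rw [genFun_kerDeltaJ n μ ν p hp, one_mul, leading_eq_transverseSym] at h1
  refine ⟨h1, fun μs => ?_⟩
  have h := h2 μs
  rwa [norm_one, one_mul, sub_zero] at h

end Kernel

end Literature.MathematicalPhysics.QuantumFieldTheory.Balaban1983to89.B12Eq441DeltaJStructure

end
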